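import Literature.AnabelianGeometry.AbsoluteAnabelian.AbsTopIProp410OpennessProofs
import Literature.AnabelianGeometry.AbsoluteAnabelian.AbsTopIProp410SelfCompletionProofs
import HarnessLib

/-!
# [AbsTopI] Prop 4.10 (iii) — both printed clauses ("`Π^tp_X → Π^tp_Y`" and "respectively,
# `Δ^tp_X → Δ^tp_Y`") AT THE CONSTRUCTION over the honest residues (proof-only)

S. Mochizuki, *Topics in Absolute Anabelian Geometry I: Generalities* [AbsTopI] (J. Math. Sci.
Univ. Tokyo 19 (2012)), Prop 4.10 (i), (iii) p. 60 / proof p. 61; manuscript pagination, lit key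
`paper:url-11ac98ba15fc`, read on the page.  Sub-DAG of record `HOME/plan/L4/SUBDAG-AbsTopI-Prop410.md`;
this file closes the abc-iut-L4-t13 gen 5 chain (`CofreeCoreComap`, `…CompatProofs`,
`…DensityProofs`, `…FiniteLevelProofs`, `…OpennessProofs`, `…SelfCompletionProofs`):

* `closure_map_deltaTemp_eq_of_denseRange` — Δ-density ⟹ `closure f(Δ^tp_X) = Δ^tp_Y`;
  `prop410iiiDeltaAt_of_prop410iiiAt` — the Δ-clause of the node ("respectively, `Δ^tp_X → Δ^tp_Y`",
  `Prop410iiiDeltaAt`) follows from the Π-clause (`Prop410iiiAt`) and Δ-density (ANY isomorphism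
  carrying `η` to `f` carries `closure η(Δ^tp_X)` to `closure f(Δ^tp_X)`);
* `prop410iiiAt_of_residues'`, `prop410iiiDeltaAt_of_residues'` — BOTH clauses of node
  `AbsTopI:Prop4.10(iii)` at the construction from: (CF′) "every open normal subgroup of `Π^tp_Y`
  contains some `K_{H′}`" (= row iii.L02 given temperedness, `selfCompletionAt_of_groupLevelData`),
  conjunct 1 of `CoFreeCofinalImAlong` (EXPECTED-TRUE, decider abc-iut-w5-d208), `Δ_X` topologically
  finitely generated, the same base field `X.K = Y.K`, abc-iut-L3's parameter bundles `GroupLevelData`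
  ("`Π^temp` tempered, Galois-countable") for `X` and `Y`, the graph-level surjectivity (R2)
  "`H′ = f(f⁻¹H′) · H′^{co-fr}`", and §0 p. 8's standing hypothesis (every Y-index admits a minimal
  co-free subgroup; [André] Lem. 6.1.1 at genuine data).

Inputs are hypotheses stated in the signatures (no new named facts; FACT-LIST untouched).
HONEST FRAMING: refereed prerequisite paper; nothing here bears on [IUTchIII] Cor 3.12; typed ≠ proved.
-/

noncomputable section

open _root_.Topology Filter

namespace Literature.AnabelianGeometry.AbsoluteAnabelian.AbsTopI.Prop410

open Literature.AnabelianGeometry.SemiGraphs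
open Literature.AnabelianGeometry.AbsoluteAnabelian.AbsTopI

variable {p : ℕ} [Fact p.Prime]

/-! ### The Δ-clause from the Π-clause and Δ-density -/

/-- **Δ-density ⟹ `closure f(Δ^tp_X) = Δ^tp_Y`** (as subgroups of `Π^tp_Y`; `Δ^tp_Y` is closed, being
the kernel of the augmentation to the Hausdorff `G_{ℚ_p}` — cf. abc-iut-L3's
`TemperedCurve.isClosed_deltaTemp`). [cite: MochizukiAbsTopI2012, Prop 4.10 (iii) p.60] -/
theorem closure_map_deltaTemp_eq_of_denseRange {X Y : TemperedCurve p} (E : DeCuspidalization X Y)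
    (hdense : DenseRange E.fDelta) :
    (X.DeltaTemp.map E.f.toMonoidHom).topologicalClosure = Y.DeltaTemp := by
  have hclosed : IsClosed (Y.DeltaTemp : Set Y.PiTemp) := by
    have hset : (Y.DeltaTemp : Set Y.PiTemp) = Y.aug ⁻¹' {1} := by
      ext g
      rw [SetLike.mem_coe, TemperedCurve.DeltaTemp, MonoidHom.mem_ker, Set.mem_preimage,
        Set.mem_singleton_iff]
      rfl
    rw [hset]
    exact isClosed_singleton.preimage Y.aug.continuous
  refine le_antisymm (Subgroup.topologicalClosure_minimal _ ?_ hclosed) ?_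
  · rintro _ ⟨g, hg, rfl⟩
    exact E.map_mem_deltaTemp hg
  · intro y hy
    have hcl : (⟨y, hy⟩ : Y.DeltaTemp) ∈ closure (Set.range E.fDelta) := hdense ⟨y, hy⟩
    rw [closure_subtype] at hcl
    have himg : (((↑) : Y.DeltaTemp → Y.PiTemp) '' Set.range E.fDelta) ⊆
        ((X.DeltaTemp.map E.f.toMonoidHom : Subgroup Y.PiTemp) : Set Y.PiTemp) := by
      rintro _ ⟨_, ⟨g, rfl⟩, rfl⟩
      exact ⟨(g : X.PiTemp), g.2, rfl⟩
    rw [← SetLike.mem_coe, Subgroup.topologicalClosure_coe]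
    exact closure_mono himg hcl

/-- **The Δ-clause of [AbsTopI] Prop 4.10 (iii) at the construction from the Π-clause and Δ-density**:
any isomorphism `e : (Π^tp_X)^{Π̂_Y/co-fr} ⥲ Π^tp_Y` carrying `η` to `f` carries the closure of
`η(Δ^tp_X)` onto the closure of `f(Δ^tp_X)`, which is `Δ^tp_Y` when `Δ^tp_X → Δ^tp_Y` is dense.
[cite: MochizukiAbsTopI2012, Prop 4.10 (iii) p.60] -/
theorem prop410iiiDeltaAt_of_prop410iiiAt {X Y : TemperedCurve p} (E : DeCuspidalization X Y)
    (h : Prop410iiiAt E) (hdense : DenseRange E.fDelta) : Prop410iiiDeltaAt E := by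
  obtain ⟨e, he⟩ := h
  refine ⟨e, he, ?_⟩
  haveI : IsTopologicalGroup (CoFreeQKit.ofConstruction X Y.PiHat E.fHat).C :=
    (CoFreeQKit.ofConstruction X Y.PiHat E.fHat).isTopologicalGroup
  rw [DLocObj.map_topologicalClosure_equiv, Subgroup.map_map]
  have hcomp : e.toMulEquiv.toMonoidHom.comp (CoFreeQKit.ofConstruction X Y.PiHat E.fHat).η.toMonoidHom =
      E.f.toMonoidHom :=
    MonoidHom.ext fun g => he g
  rw [hcomp]
  exact closure_map_deltaTemp_eq_of_denseRange E hdense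

/-! ### Both clauses of the node over the honest residues -/

/-- **[AbsTopI] Prop 4.10 (iii), Π-clause, AT THE CONSTRUCTION over the honest residues** with (i)
for `Y` replaced by the neighbourhood-basis condition (CF′) (row iii.L02 given temperedness).
[cite: MochizukiAbsTopI2012, Prop 4.10 (iii) p.60] -/
theorem prop410iiiAt_of_residues' {X Y : TemperedCurve p} (E : DeCuspidalization X Y)
    (hCF : ∀ N : OpenNormalSubgroup Y.PiTemp, ∃ H' : CharOpenSubgroup Y.DeltaTemp,
      CoFreeCompletion.piKer ((ContinuousMonoidHom.id Y.PiHat).comp Y.toHat) Y.DeltaTemp H' ≤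
        N.toSubgroup)
    (hleft : ∀ H : CharOpenSubgroup X.DeltaTemp, ∃ H' : CharOpenSubgroup Y.DeltaTemp,
      coFreeKernel ((ContinuousMonoidHom.id Y.PiHat).comp Y.toHat) H'.toSubgroup ≤
        coFreeKernel (E.fHat.comp X.toHat) H.toSubgroup)
    (hfg : IsTopologicallyFinitelyGenerated X.DeltaHat) (hK : X.K = Y.K)
    (dX : X.GroupLevelData) (dY : Y.GroupLevelData)
    (hR2 : ∀ H' : CharOpenSubgroup Y.DeltaTemp,
      H'.toSubgroup ≤ (H'.toSubgroup.comap E.f.toMonoidHom).map E.f.toMonoidHom ⊔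
        cofreeCore H'.toSubgroup)
    (hmin : ∀ H' : CharOpenSubgroup Y.DeltaTemp, ∃ M, IsMinimalCofreeIn H'.toSubgroup M) :
    Prop410iiiAt E :=
  prop410iiiAt_of_residues E (selfCompletionAt_of_groupLevelData dY hCF) hleft hfg hK dX dY hR2 hmin

/-- **[AbsTopI] Prop 4.10 (iii), Δ-clause ("respectively, `Δ^tp_X → Δ^tp_Y`"), AT THE CONSTRUCTION
over the same honest residues** (Δ-density being a theorem from (R2) at genuine data).
[cite: MochizukiAbsTopI2012, Prop 4.10 (iii) p.60] -/
theorem prop410iiiDeltaAt_of_residues' {X Y : TemperedCurve p} (E : DeCuspidalization X Y)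
    (hCF : ∀ N : OpenNormalSubgroup Y.PiTemp, ∃ H' : CharOpenSubgroup Y.DeltaTemp,
      CoFreeCompletion.piKer ((ContinuousMonoidHom.id Y.PiHat).comp Y.toHat) Y.DeltaTemp H' ≤
        N.toSubgroup)
    (hleft : ∀ H : CharOpenSubgroup X.DeltaTemp, ∃ H' : CharOpenSubgroup Y.DeltaTemp,
      coFreeKernel ((ContinuousMonoidHom.id Y.PiHat).comp Y.toHat) H'.toSubgroup ≤
        coFreeKernel (E.fHat.comp X.toHat) H.toSubgroup)
    (hfg : IsTopologicallyFinitelyGenerated X.DeltaHat) (hK : X.K = Y.K)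
    (dX : X.GroupLevelData) (dY : Y.GroupLevelData)
    (hR2 : ∀ H' : CharOpenSubgroup Y.DeltaTemp,
      H'.toSubgroup ≤ (H'.toSubgroup.comap E.f.toMonoidHom).map E.f.toMonoidHom ⊔
        cofreeCore H'.toSubgroup)
    (hmin : ∀ H' : CharOpenSubgroup Y.DeltaTemp, ∃ M, IsMinimalCofreeIn H'.toSubgroup M) :
    Prop410iiiDeltaAt E :=
  prop410iiiDeltaAt_of_prop410iiiAt E (prop410iiiAt_of_residues' E hCF hleft hfg hK dX dY hR2 hmin)
    (denseRange_fDelta_of_graphSurj E (selfCompletionAt_of_groupLevelData dY hCF) dX dY hR2)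

end Literature.AnabelianGeometry.AbsoluteAnabelian.AbsTopI.Prop410

end
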